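import Summits.QuantumAdvantage.QuantumAdvantage.Theorems.SosSandwichPseudoBoundedClosure
import Literature.Computability.QuantumComplexity.InfluenceBounds

/-!
# Route `SosSandwich`, support `HomogeneousPBAA` (stmt-QuantumAdvantage-15241; stub `stub_homogeneousRung` of
crux `PseudoBoundedAA`, stmt-QuantumAdvantage-15237) — XOR-composition preserves the top-homogeneous sandwich class

The class of the stub — `p ∈ K_T` (pseudo-bounded of order `T`) whose centred part satisfies the Laplacian
eigen-equation `Σᵢ (p − p∘flipᵢ) = 4T (p − E p)` — is closed under XOR-COMPOSITION on disjoint blocks of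
variables: for `p₁` on `Fin N₁` and `p₂` on `Fin N₂`,

  `p₁ ⊕ p₂ := p₁ p₂ + (1 − p₁)(1 − p₂)`  on `Fin (N₁ + N₂)` (blocks embedded by `Fin.castAdd` / `Fin.natAdd`)

is pseudo-bounded of order `T₁ + T₂` (products and sums of cube-SOS certificates; its complement is
`p₁(1 − p₂) + (1 − p₁)p₂`), has mean `m₁m₂ + (1 − m₁)(1 − m₂)`, and — when `E p₁ = E p₂ = 1/2`, so that
`p₁ ⊕ p₂ = 1/2 + 2 g₁ g₂` with `gᵢ = pᵢ − 1/2` — satisfies the Laplacian eigen-equation of order `T₁ + T₂`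
(`L(g₁g₂) = (L₁g₁) g₂ + g₁ (L₂ g₂)` on disjoint blocks). Together with disjoint averaging (`convexComb` + `rename`)
this generates, from the seeds `(1 + χ_S)/2`, infinite families inside the stub's hypothesis class on which any
proposed constant / counterexample for `HomogeneousPBAA` can be tested (`Var[p₁ ⊕ p₂] = 4 Var[p₁] Var[p₂]`).

* `evalBool_rename_castAdd`, `evalBool_rename_natAdd` — block embeddings evaluate on the block;
* `flipBit_castAdd_comp_castAdd`, `flipBit_castAdd_comp_natAdd`, `flipBit_natAdd_comp_castAdd`,
  `flipBit_natAdd_comp_natAdd` — a flip in one block is a flip of that block and leaves the other block alone;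
* `sum_cube_append` — `Σ_{z ∈ {0,1}^{N₁+N₂}} F(z|₁, z|₂) = Σ_x Σ_y F(x, y)`;
* `pseudoBounded_xor` — `p₁ ⊕ p₂ ∈ K_{T₁+T₂}`;
* `boolAvg_xor` — `E[p₁ ⊕ p₂] = m₁ m₂ + (1 − m₁)(1 − m₂)`;
* `laplacian_xor` — the eigen-equation of order `T₁ + T₂` for `p₁ ⊕ p₂` from those of `p₁`, `p₂` (means `1/2`).

All proved, no named fact. [cite: ODonnell2014, §2.3 (Laplacian), Ex. 2.4-style composition] [cite: KaniewskiLeeDewolf2015, Def. 7]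
-/

set_option linter.dupNamespace false -- D-0017: single-problem summit ⇒ `QuantumAdvantage.QuantumAdvantage` by design

namespace Summit.QuantumAdvantage.QuantumAdvantage.Theorems.SosSandwich

open Finset MvPolynomial Literature.Computability.QuantumComplexity

variable {N₁ N₂ : ℕ}

/-! ### Block embeddings -/

/-- The first-block embedding evaluates on the first block. [folklore] -/
theorem evalBool_rename_castAdd (p : MvPolynomial (Fin N₁) ℝ) (z : Fin (N₁ + N₂) → Bool) :
    evalBool (rename (Fin.castAdd N₂) p) z = evalBool p (z ∘ Fin.castAdd N₂) := by
  unfold evalBool; rw [eval_rename]; rfl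

/-- The second-block embedding evaluates on the second block. [folklore] -/
theorem evalBool_rename_natAdd (p : MvPolynomial (Fin N₂) ℝ) (z : Fin (N₁ + N₂) → Bool) :
    evalBool (rename (Fin.natAdd N₁) p) z = evalBool p (z ∘ Fin.natAdd N₁) := by
  unfold evalBool; rw [eval_rename]; rfl

/-- Flipping a first-block bit, seen on the first block, is the flip there. [folklore] -/
theorem flipBit_castAdd_comp_castAdd (z : Fin (N₁ + N₂) → Bool) (i : Fin N₁) :
    flipBit (Fin.castAdd N₂ i) z ∘ Fin.castAdd N₂ = flipBit i (z ∘ Fin.castAdd N₂) := by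
  unfold flipBit
  rw [Function.update_comp_eq_of_injective z (Fin.castAdd_injective N₁ N₂) i]
  rfl

/-- Flipping a first-block bit does not touch the second block. [folklore] -/
theorem flipBit_castAdd_comp_natAdd (z : Fin (N₁ + N₂) → Bool) (i : Fin N₁) :
    flipBit (Fin.castAdd N₂ i) z ∘ Fin.natAdd N₁ = z ∘ Fin.natAdd N₁ := by
  unfold flipBit
  -- indices of the two blocks never coincide (`Fin.val` comparison)
  exact Function.update_comp_eq_of_forall_ne _ _ fun j h => by
    have := congrArg Fin.val h
    simp at this
    omega

/-- Flipping a second-block bit does not touch the first block. [folklore] -/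
theorem flipBit_natAdd_comp_castAdd (z : Fin (N₁ + N₂) → Bool) (j : Fin N₂) :
    flipBit (Fin.natAdd N₁ j) z ∘ Fin.castAdd N₂ = z ∘ Fin.castAdd N₂ := by
  unfold flipBit
  exact Function.update_comp_eq_of_forall_ne _ _ fun i h => by
    have := congrArg Fin.val h
    simp at this
    omega

/-- Flipping a second-block bit, seen on the second block, is the flip there. [folklore] -/
theorem flipBit_natAdd_comp_natAdd (z : Fin (N₁ + N₂) → Bool) (j : Fin N₂) :
    flipBit (Fin.natAdd N₁ j) z ∘ Fin.natAdd N₁ = flipBit j (z ∘ Fin.natAdd N₁) := by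
  unfold flipBit
  rw [Function.update_comp_eq_of_injective z (Fin.natAdd_injective N₂ N₁) j]
  rfl

/-- **Product cube**: a sum over `{0,1}^{N₁+N₂}` of a function of the two blocks is the double sum.
[folklore] -/
theorem sum_cube_append (F : (Fin N₁ → Bool) → (Fin N₂ → Bool) → ℝ) :
    ∑ z : Fin (N₁ + N₂) → Bool, F (z ∘ Fin.castAdd N₂) (z ∘ Fin.natAdd N₁) =
      ∑ x : Fin N₁ → Bool, ∑ y : Fin N₂ → Bool, F x y := by
  let e : (Fin N₁ → Bool) × (Fin N₂ → Bool) ≃ (Fin (N₁ + N₂) → Bool) :=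
    { toFun := fun xy => Fin.append xy.1 xy.2
      invFun := fun z => (z ∘ Fin.castAdd N₂, z ∘ Fin.natAdd N₁)
      left_inv := fun xy => by
        ext i
        · simp
        · simp
      right_inv := fun z => Fin.append_castAdd_natAdd }
  rw [← Fintype.sum_equiv e (fun xy => F xy.1 xy.2)
      (fun z => F (z ∘ Fin.castAdd N₂) (z ∘ Fin.natAdd N₁)) (fun xy => ?_)]
  · exact Fintype.sum_prod_type _
  · -- `F ((append x y)|₁, (append x y)|₂) = F x y`
    show F xy.1 xy.2 = F (Fin.append xy.1 xy.2 ∘ Fin.castAdd N₂) (Fin.append xy.1 xy.2 ∘ Fin.natAdd N₁)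
    congr 1
    · funext i; simp
    · funext j; simp

/-- Block-product averages factor: `E_z[f(z|₁) h(z|₂)] = E_x f · E_y h`. [folklore] -/
theorem boolAvg_blockMul (f : (Fin N₁ → Bool) → ℝ) (h : (Fin N₂ → Bool) → ℝ) :
    boolAvg (fun z : Fin (N₁ + N₂) → Bool => f (z ∘ Fin.castAdd N₂) * h (z ∘ Fin.natAdd N₁)) =
      boolAvg f * boolAvg h := by
  unfold boolAvg
  rw [sum_cube_append (fun x y => f x * h y)]
  simp_rw [← Finset.mul_sum]
  rw [← Finset.sum_mul, pow_add]
  field_simp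

/-! ### The XOR-composition `p₁ ⊕ p₂ = p₁ p₂ + (1 − p₁)(1 − p₂)` -/

/-- **`K` is closed under XOR-composition**: `p₁ p₂ + (1−p₁)(1−p₂) ∈ K_{T₁+T₂}` on the disjoint union of the
variable blocks (its complement is `p₁(1−p₂) + (1−p₁)p₂`; products and sums of cube-SOS certificates).
[cite: KaniewskiLeeDewolf2015, Def. 7] -/
theorem pseudoBounded_xor {T₁ T₂ : ℕ} {p₁ : MvPolynomial (Fin N₁) ℝ} {p₂ : MvPolynomial (Fin N₂) ℝ}
    (h₁ : PseudoBounded T₁ p₁) (h₂ : PseudoBounded T₂ p₂) :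
    PseudoBounded (T₁ + T₂)
      (rename (Fin.castAdd N₂) p₁ * rename (Fin.natAdd N₁) p₂ +
        (1 - rename (Fin.castAdd N₂) p₁) * (1 - rename (Fin.natAdd N₁) p₂)) := by
  have hP₁ := PseudoBounded.rename (Fin.castAdd N₂) h₁
  have hP₂ := PseudoBounded.rename (Fin.natAdd N₁) h₂
  rw [pseudoBounded_iff_cubeSOS] at hP₁ hP₂ ⊢
  obtain ⟨a₁, b₁⟩ := hP₁
  obtain ⟨a₂, b₂⟩ := hP₂
  refine ⟨((a₁.mul a₂).add (b₁.mul b₂)).congr fun z => ?_, ((a₁.mul b₂).add (b₁.mul a₂)).congr fun z => ?_⟩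
  · unfold evalBool
    simp only [map_add, map_mul, map_sub, map_one]
  · unfold evalBool
    simp only [map_add, map_mul, map_sub, map_one]
    ring

/-- Mean of the XOR-composition: `E[p₁ ⊕ p₂] = m₁ m₂ + (1 − m₁)(1 − m₂)`. [folklore] -/
theorem boolAvg_xor (p₁ : MvPolynomial (Fin N₁) ℝ) (p₂ : MvPolynomial (Fin N₂) ℝ) :
    boolAvg (evalBool (rename (Fin.castAdd N₂) p₁ * rename (Fin.natAdd N₁) p₂ +
        (1 - rename (Fin.castAdd N₂) p₁) * (1 - rename (Fin.natAdd N₁) p₂))) =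
      boolAvg (evalBool p₁) * boolAvg (evalBool p₂) +
        (1 - boolAvg (evalBool p₁)) * (1 - boolAvg (evalBool p₂)) := by
  have key : evalBool (rename (Fin.castAdd N₂) p₁ * rename (Fin.natAdd N₁) p₂ +
        (1 - rename (Fin.castAdd N₂) p₁) * (1 - rename (Fin.natAdd N₁) p₂)) =
      fun z : Fin (N₁ + N₂) → Bool =>
        (evalBool p₁ (z ∘ Fin.castAdd N₂)) * (evalBool p₂ (z ∘ Fin.natAdd N₁)) +
          (1 - evalBool p₁ (z ∘ Fin.castAdd N₂)) * (1 - evalBool p₂ (z ∘ Fin.natAdd N₁)) := by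
    funext z
    rw [← evalBool_rename_castAdd, ← evalBool_rename_natAdd]
    unfold evalBool
    simp only [map_add, map_mul, map_sub, map_one]
  rw [key]
  have h1 := boolAvg_blockMul (N₁ := N₁) (N₂ := N₂) (evalBool p₁) (evalBool p₂)
  have h2 := boolAvg_blockMul (N₁ := N₁) (N₂ := N₂) (fun x => 1 - evalBool p₁ x) (fun y => 1 - evalBool p₂ y)
  have hsplit : boolAvg (fun z : Fin (N₁ + N₂) → Bool =>
      evalBool p₁ (z ∘ Fin.castAdd N₂) * evalBool p₂ (z ∘ Fin.natAdd N₁) +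
        (1 - evalBool p₁ (z ∘ Fin.castAdd N₂)) * (1 - evalBool p₂ (z ∘ Fin.natAdd N₁))) =
      boolAvg (fun z : Fin (N₁ + N₂) → Bool => evalBool p₁ (z ∘ Fin.castAdd N₂) * evalBool p₂ (z ∘ Fin.natAdd N₁)) +
      boolAvg (fun z : Fin (N₁ + N₂) → Bool =>
        (1 - evalBool p₁ (z ∘ Fin.castAdd N₂)) * (1 - evalBool p₂ (z ∘ Fin.natAdd N₁))) := by
    unfold boolAvg; rw [← add_div, ← Finset.sum_add_distrib]
  have hc1 : boolAvg (fun x : Fin N₁ → Bool => 1 - evalBool p₁ x) = 1 - boolAvg (evalBool p₁) := by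
    unfold boolAvg
    rw [Finset.sum_sub_distrib, Finset.sum_const, Finset.card_univ, sub_div]
    simp [Fintype.card_bool, Fintype.card_fin]
  have hc2 : boolAvg (fun y : Fin N₂ → Bool => 1 - evalBool p₂ y) = 1 - boolAvg (evalBool p₂) := by
    unfold boolAvg
    rw [Finset.sum_sub_distrib, Finset.sum_const, Finset.card_univ, sub_div]
    simp [Fintype.card_bool, Fintype.card_fin]
  rw [hsplit, h1, h2, hc1, hc2]

/-- **The Laplacian eigen-equation composes under XOR.** If `Σᵢ (p₁ − p₁∘flipᵢ) = 4T₁ (p₁ − E p₁)` and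
`Σⱼ (p₂ − p₂∘flipⱼ) = 4T₂ (p₂ − E p₂)` pointwise, with `E p₁ = E p₂ = 1/2`, then `p₁ ⊕ p₂ = 1/2 + 2 g₁ g₂`
(`gᵢ = pᵢ − 1/2`) satisfies `Σ_k (p − p∘flip_k) = 4(T₁+T₂)(p − E p)` and `E p = 1/2`: the hypothesis class of
`HomogeneousPBAA` is closed under XOR-composition. [cite: ODonnell2014, §2.3] -/
theorem laplacian_xor {T₁ T₂ : ℕ} (p₁ : MvPolynomial (Fin N₁) ℝ) (p₂ : MvPolynomial (Fin N₂) ℝ)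
    (hH₁ : ∀ x : Fin N₁ → Bool, ∑ i, (evalBool p₁ x - evalBool p₁ (flipBit i x)) =
      4 * (T₁ : ℝ) * (evalBool p₁ x - boolAvg (evalBool p₁)))
    (hH₂ : ∀ y : Fin N₂ → Bool, ∑ j, (evalBool p₂ y - evalBool p₂ (flipBit j y)) =
      4 * (T₂ : ℝ) * (evalBool p₂ y - boolAvg (evalBool p₂)))
    (hm₁ : boolAvg (evalBool p₁) = 1 / 2) (hm₂ : boolAvg (evalBool p₂) = 1 / 2) :
    let p : MvPolynomial (Fin (N₁ + N₂)) ℝ :=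
      rename (Fin.castAdd N₂) p₁ * rename (Fin.natAdd N₁) p₂ +
        (1 - rename (Fin.castAdd N₂) p₁) * (1 - rename (Fin.natAdd N₁) p₂)
    boolAvg (evalBool p) = 1 / 2 ∧
      ∀ z : Fin (N₁ + N₂) → Bool, ∑ k, (evalBool p z - evalBool p (flipBit k z)) =
        4 * ((T₁ + T₂ : ℕ) : ℝ) * (evalBool p z - boolAvg (evalBool p)) := by
  intro p
  have hmean : boolAvg (evalBool p) = 1 / 2 := by
    show boolAvg (evalBool (rename (Fin.castAdd N₂) p₁ * rename (Fin.natAdd N₁) p₂ +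
        (1 - rename (Fin.castAdd N₂) p₁) * (1 - rename (Fin.natAdd N₁) p₂))) = 1 / 2
    rw [boolAvg_xor, hm₁, hm₂]; norm_num
  refine ⟨hmean, fun z => ?_⟩
  -- pointwise form of `p`: `p(w) = 1/2 + 2 g₁(w|₁) g₂(w|₂)`
  have hp : ∀ w : Fin (N₁ + N₂) → Bool, evalBool p w =
      1 / 2 + 2 * (evalBool p₁ (w ∘ Fin.castAdd N₂) - 1 / 2) * (evalBool p₂ (w ∘ Fin.natAdd N₁) - 1 / 2) := by
    intro w
    show evalBool (rename (Fin.castAdd N₂) p₁ * rename (Fin.natAdd N₁) p₂ +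
        (1 - rename (Fin.castAdd N₂) p₁) * (1 - rename (Fin.natAdd N₁) p₂)) w = _
    rw [← evalBool_rename_castAdd, ← evalBool_rename_natAdd]
    unfold evalBool
    simp only [map_add, map_mul, map_sub, map_one]
    ring
  set x : Fin N₁ → Bool := z ∘ Fin.castAdd N₂ with hx
  set y : Fin N₂ → Bool := z ∘ Fin.natAdd N₁ with hy
  set g₁ : (Fin N₁ → Bool) → ℝ := fun u => evalBool p₁ u - 1 / 2 with hg₁
  set g₂ : (Fin N₂ → Bool) → ℝ := fun v => evalBool p₂ v - 1 / 2 with hg₂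
  -- the two blocks of the sum
  have hblk1 : ∀ i : Fin N₁, evalBool p z - evalBool p (flipBit (Fin.castAdd N₂ i) z) =
      2 * (g₁ x - g₁ (flipBit i x)) * g₂ y := by
    intro i
    rw [hp z, hp (flipBit (Fin.castAdd N₂ i) z), flipBit_castAdd_comp_castAdd, flipBit_castAdd_comp_natAdd]
    simp only [hg₁, hg₂, hx, hy]
    ring
  have hblk2 : ∀ j : Fin N₂, evalBool p z - evalBool p (flipBit (Fin.natAdd N₁ j) z) =
      2 * g₁ x * (g₂ y - g₂ (flipBit j y)) := by
    intro j
    rw [hp z, hp (flipBit (Fin.natAdd N₁ j) z), flipBit_natAdd_comp_castAdd, flipBit_natAdd_comp_natAdd]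
    simp only [hg₁, hg₂, hx, hy]
    ring
  -- the block Laplacians
  have hL₁ : ∑ i : Fin N₁, (g₁ x - g₁ (flipBit i x)) = 4 * (T₁ : ℝ) * g₁ x := by
    have := hH₁ x
    rw [hm₁] at this
    simp only [hg₁]
    simpa using this
  have hL₂ : ∑ j : Fin N₂, (g₂ y - g₂ (flipBit j y)) = 4 * (T₂ : ℝ) * g₂ y := by
    have := hH₂ y
    rw [hm₂] at this
    simp only [hg₂]
    simpa using this
  rw [Fin.sum_univ_add]
  simp_rw [hblk1, hblk2]
  rw [show ∑ i : Fin N₁, 2 * (g₁ x - g₁ (flipBit i x)) * g₂ y = 2 * g₂ y * ∑ i : Fin N₁, (g₁ x - g₁ (flipBit i x)) by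
        rw [Finset.mul_sum]; exact Finset.sum_congr rfl fun i _ => by ring,
      show ∑ j : Fin N₂, 2 * g₁ x * (g₂ y - g₂ (flipBit j y)) = 2 * g₁ x * ∑ j : Fin N₂, (g₂ y - g₂ (flipBit j y)) by
        rw [Finset.mul_sum],
      hL₁, hL₂, hmean, hp z]
  push_cast
  ring


/-! ### Variance and influences of the XOR-composition -/

/-- Pointwise form of the XOR-composition: `p₁ ⊕ p₂ = 1/2 + 2 (p₁ − 1/2)(p₂ − 1/2)` on the two blocks. [folklore] -/
theorem evalBool_xor (p₁ : MvPolynomial (Fin N₁) ℝ) (p₂ : MvPolynomial (Fin N₂) ℝ) (w : Fin (N₁ + N₂) → Bool) :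
    evalBool (rename (Fin.castAdd N₂) p₁ * rename (Fin.natAdd N₁) p₂ +
        (1 - rename (Fin.castAdd N₂) p₁) * (1 - rename (Fin.natAdd N₁) p₂)) w =
      1 / 2 + 2 * (evalBool p₁ (w ∘ Fin.castAdd N₂) - 1 / 2) * (evalBool p₂ (w ∘ Fin.natAdd N₁) - 1 / 2) := by
  rw [← evalBool_rename_castAdd, ← evalBool_rename_natAdd]
  unfold evalBool
  simp only [map_add, map_mul, map_sub, map_one]
  ring

/-- **Variance of the XOR-composition** (centred factors): `Var[p₁ ⊕ p₂] = 4 Var[p₁] Var[p₂]`. [folklore] -/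
theorem boolVariance_xor (p₁ : MvPolynomial (Fin N₁) ℝ) (p₂ : MvPolynomial (Fin N₂) ℝ)
    (hm₁ : boolAvg (evalBool p₁) = 1 / 2) (hm₂ : boolAvg (evalBool p₂) = 1 / 2) :
    boolVariance (rename (Fin.castAdd N₂) p₁ * rename (Fin.natAdd N₁) p₂ +
        (1 - rename (Fin.castAdd N₂) p₁) * (1 - rename (Fin.natAdd N₁) p₂)) =
      4 * boolVariance p₁ * boolVariance p₂ := by
  have hmean : boolAvg (evalBool (rename (Fin.castAdd N₂) p₁ * rename (Fin.natAdd N₁) p₂ +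
      (1 - rename (Fin.castAdd N₂) p₁) * (1 - rename (Fin.natAdd N₁) p₂))) = 1 / 2 := by
    rw [boolAvg_xor, hm₁, hm₂]; norm_num
  unfold boolVariance
  rw [hmean, hm₁, hm₂]
  have hfun : (fun z : Fin (N₁ + N₂) → Bool =>
      (evalBool (rename (Fin.castAdd N₂) p₁ * rename (Fin.natAdd N₁) p₂ +
          (1 - rename (Fin.castAdd N₂) p₁) * (1 - rename (Fin.natAdd N₁) p₂)) z - 1 / 2) ^ 2) =
      fun z => (4 * (evalBool p₁ (z ∘ Fin.castAdd N₂) - 1 / 2) ^ 2) *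
        (evalBool p₂ (z ∘ Fin.natAdd N₁) - 1 / 2) ^ 2 := by
    funext z; rw [evalBool_xor]; ring
  rw [hfun, boolAvg_blockMul (fun x => 4 * (evalBool p₁ x - 1 / 2) ^ 2) (fun y => (evalBool p₂ y - 1 / 2) ^ 2)]
  have h4 : boolAvg (fun x : Fin N₁ → Bool => 4 * (evalBool p₁ x - 1 / 2) ^ 2) =
      4 * boolAvg (fun x : Fin N₁ → Bool => (evalBool p₁ x - 1 / 2) ^ 2) := by
    unfold boolAvg; rw [← Finset.mul_sum, mul_div_assoc]
  rw [h4]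

/-- **Influence of a first-block variable in the XOR-composition**: `Inf_{i}[p₁ ⊕ p₂] = 4 Inf_i[p₁] · Var[p₂]`
(second factor centred). [folklore] -/
theorem influence_xor_castAdd (p₁ : MvPolynomial (Fin N₁) ℝ) (p₂ : MvPolynomial (Fin N₂) ℝ)
    (hm₂ : boolAvg (evalBool p₂) = 1 / 2) (i : Fin N₁) :
    influence (Fin.castAdd N₂ i) (rename (Fin.castAdd N₂) p₁ * rename (Fin.natAdd N₁) p₂ +
        (1 - rename (Fin.castAdd N₂) p₁) * (1 - rename (Fin.natAdd N₁) p₂)) =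
      4 * influence i p₁ * boolVariance p₂ := by
  unfold influence boolVariance
  rw [hm₂]
  have hfun : (fun z : Fin (N₁ + N₂) → Bool =>
      (evalBool (rename (Fin.castAdd N₂) p₁ * rename (Fin.natAdd N₁) p₂ +
          (1 - rename (Fin.castAdd N₂) p₁) * (1 - rename (Fin.natAdd N₁) p₂)) z -
        evalBool (rename (Fin.castAdd N₂) p₁ * rename (Fin.natAdd N₁) p₂ +
          (1 - rename (Fin.castAdd N₂) p₁) * (1 - rename (Fin.natAdd N₁) p₂)) (flipBit (Fin.castAdd N₂ i) z)) ^ 2) =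
      fun z => (4 * (evalBool p₁ (z ∘ Fin.castAdd N₂) - evalBool p₁ (flipBit i (z ∘ Fin.castAdd N₂))) ^ 2) *
        (evalBool p₂ (z ∘ Fin.natAdd N₁) - 1 / 2) ^ 2 := by
    funext z
    rw [evalBool_xor, evalBool_xor, flipBit_castAdd_comp_castAdd, flipBit_castAdd_comp_natAdd]
    ring
  rw [hfun, boolAvg_blockMul (fun x => 4 * (evalBool p₁ x - evalBool p₁ (flipBit i x)) ^ 2)
    (fun y => (evalBool p₂ y - 1 / 2) ^ 2)]
  have h4 : boolAvg (fun x : Fin N₁ → Bool => 4 * (evalBool p₁ x - evalBool p₁ (flipBit i x)) ^ 2) =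
      4 * boolAvg (fun x : Fin N₁ → Bool => (evalBool p₁ x - evalBool p₁ (flipBit i x)) ^ 2) := by
    unfold boolAvg; rw [← Finset.mul_sum, mul_div_assoc]
  rw [h4]

/-- **Influence of a second-block variable in the XOR-composition**: `Inf_{j}[p₁ ⊕ p₂] = 4 Var[p₁] · Inf_j[p₂]`
(first factor centred). Consequently, with `r(p) := maxInf/Var²`, `r(p₁ ⊕ p₂) = max(r(p₁)/(4Var[p₂]), r(p₂)/(4Var[p₁]))
≥ max(r(p₁), r(p₂))` since `Var ≤ 1/4`: XOR-composition never lowers the ratio tested by `HomogeneousPBAA`. [folklore] -/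
theorem influence_xor_natAdd (p₁ : MvPolynomial (Fin N₁) ℝ) (p₂ : MvPolynomial (Fin N₂) ℝ)
    (hm₁ : boolAvg (evalBool p₁) = 1 / 2) (j : Fin N₂) :
    influence (Fin.natAdd N₁ j) (rename (Fin.castAdd N₂) p₁ * rename (Fin.natAdd N₁) p₂ +
        (1 - rename (Fin.castAdd N₂) p₁) * (1 - rename (Fin.natAdd N₁) p₂)) =
      4 * boolVariance p₁ * influence j p₂ := by
  unfold influence boolVariance
  rw [hm₁]
  have hfun : (fun z : Fin (N₁ + N₂) → Bool =>
      (evalBool (rename (Fin.castAdd N₂) p₁ * rename (Fin.natAdd N₁) p₂ +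
          (1 - rename (Fin.castAdd N₂) p₁) * (1 - rename (Fin.natAdd N₁) p₂)) z -
        evalBool (rename (Fin.castAdd N₂) p₁ * rename (Fin.natAdd N₁) p₂ +
          (1 - rename (Fin.castAdd N₂) p₁) * (1 - rename (Fin.natAdd N₁) p₂)) (flipBit (Fin.natAdd N₁ j) z)) ^ 2) =
      fun z => (4 * (evalBool p₁ (z ∘ Fin.castAdd N₂) - 1 / 2) ^ 2) *
        (evalBool p₂ (z ∘ Fin.natAdd N₁) - evalBool p₂ (flipBit j (z ∘ Fin.natAdd N₁))) ^ 2 := by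
    funext z
    rw [evalBool_xor, evalBool_xor, flipBit_natAdd_comp_castAdd, flipBit_natAdd_comp_natAdd]
    ring
  rw [hfun, boolAvg_blockMul (fun x => 4 * (evalBool p₁ x - 1 / 2) ^ 2)
    (fun y => (evalBool p₂ y - evalBool p₂ (flipBit j y)) ^ 2)]
  have h4 : boolAvg (fun x : Fin N₁ → Bool => 4 * (evalBool p₁ x - 1 / 2) ^ 2) =
      4 * boolAvg (fun x : Fin N₁ → Bool => (evalBool p₁ x - 1 / 2) ^ 2) := by
    unfold boolAvg; rw [← Finset.mul_sum, mul_div_assoc]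
  rw [h4]

end Summit.QuantumAdvantage.QuantumAdvantage.Theorems.SosSandwich
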